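/-
Copyright (c) 2026. All rights reserved.
Released under Apache 2.0 license as described in the file LICENSE.
Authors: abc-iut cell, cone prover seat abc-iut-w6-d032 (wave W6, block C).
-/
import Literature.AnabelianGeometry.EtaleTheta.ThetaCovers
import Literature.AnabelianGeometry.EtaleTheta.Discharge.Sec2Prop22iiiOfCoverData

/-!
# [EtTh] Definitions 2.1 / 2.3, "arises, up to isomorphism, as": the predicates `OfTypeLTors`,
# `OfTypeLTorsPm`, `OfTypeLTorsTheta`, `OfTypeLTorsThetaPm` — PROOF-ONLY API

Mochizuki, *The Étale Theta Function and its Frobenioid-theoretic Manifestations* [EtTh], Publ. RIMS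
45 (2009), §2, Definition 2.1 (PRIMS p.36) and Definition 2.3 (p.38), bib key `MochizukiEtTh2009`:
"We shall refer to a smooth log orbicurve over `K` that arises, up to isomorphism, as `X̲^log`
(respectively, `C̲^log`) for some choice of `Π̄^ell_X ↠ Q` as being of type `(1, l-tors)` (respectively,
`(1, l-tors)±`)" and, Def 2.3, "… as `X̲̲^log` (respectively, `C̲̲^log`) … of type `(1, l-torsΘ)`
(respectively, `(1, l-torsΘ)±`)".

PROOF-ONLY companion of abc-iut-L2-t2's statement file `ThetaCovers.lean` (p405102), where these four
notions are the predicates `CoverData.OfTypeLTors` / `OfTypeLTorsPm` / `OfTypeLTorsTheta` /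
`OfTypeLTorsThetaPm` on a subgroup of `Π_C` ("some `Π_C`-conjugate is a `Π_X̲` / `Π_C̲` / `Π_X̲̲` /
`Π_C̲̲` of the construction").  They are VOCABULARY (FACT-LIST rows F-0592 – F-0595 of the abc-iut
cell), i.e. DEFINITIONS of print, not assertions; this file supplies the elementary API that the
phrase "arises, up to isomorphism, as" carries, all PROVED from the interface, for EVERY
`X : CoverData l`:

* introduction rules: a subgroup produced by the construction is of the corresponding type
  (`IsTypeLTors.ofTypeLTors`, `IsTypeLTorsPm.ofTypeLTorsPm`, `IsTypeLTorsTheta.ofTypeLTorsTheta`,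
  `IsTypeLTorsThetaPm.ofTypeLTorsThetaPm`; and from the Prop 2.2 data, `ofTypeLTorsTheta_of_data`,
  `ofTypeLTorsThetaPm_of_data`);
* "up to isomorphism" = invariance under `Π_C`-conjugation (`ofTypeLTors_map_conj_iff` and its three
  siblings) — over the `K`-core `C`, `K`-isomorphism classes of such covers are `Π_C`-conjugacy classes
  (statement file, docstring of `OfTypeLTors`);
* consequences for a curve of type `(1, l-tors)`: `Π ≤ Π_X` and `[Π_X : Π] = l` (Remark 2.3.1, "extracting
  a single copy of `ℤ/lℤ`", in the up-to-isomorphism form: `OfTypeLTors.le_PiX`, `OfTypeLTors.relIndex_eq`);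
* the degenerate arguments are excluded: `Π_C` itself is of none of the types `(1, l-tors)`,
  `(1, l-torsΘ)`, and the trivial subgroup is of none of the types `(1, l-tors)±`, `(1, l-torsΘ)±`
  (`not_ofTypeLTors_top`, `not_ofTypeLTorsTheta_top`, `not_ofTypeLTorsPm_bot`, `not_ofTypeLTorsThetaPm_bot`)
  — so none of the four predicates holds of every subgroup (their universal closures are refuted at any
  inhabitant of the interface; kernel instances over the Heisenberg toy of abc-iut-w5-d243 are in the
  sibling file `ThetaCoversOfTypeClosure.lean`).

No new definitions, no `sorry`; nothing here concerns any disputed claim ([EtTh] §2 is group theory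
over the typed interface; typed ≠ faithful-to-print, which is the referee lanes' business).
-/

namespace Literature.AnabelianGeometry.EtaleTheta

namespace ThetaCovers

namespace CoverData

universe u

variable {l : ℕ} (X : CoverData.{u} l)

/-! ## Conjugation bookkeeping in `Π_C` -/

/-- Conjugating a subgroup by `1` does nothing: `H^{1} = H`.
(bookkeeping for "up to isomorphism" in [EtTh] Def 2.1) [cite: MochizukiEtTh2009, Def 2.1 p.36] -/
theorem map_conj_one {G : Type*} [Group G] (H : Subgroup G) :
    H.map (MulAut.conj (1 : G)).toMonoidHom = H := by
  ext x
  simp [Subgroup.mem_map]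

/-- Iterated conjugation: `(H^{d})^{c} = H^{c d}`.
(bookkeeping for "up to isomorphism" in [EtTh] Def 2.1) [cite: MochizukiEtTh2009, Def 2.1 p.36] -/
theorem map_conj_map_conj {G : Type*} [Group G] (H : Subgroup G) (c d : G) :
    (H.map (MulAut.conj d).toMonoidHom).map (MulAut.conj c).toMonoidHom =
      H.map (MulAut.conj (c * d)).toMonoidHom := by
  rw [Subgroup.map_map]
  congr 1
  ext x
  simp [MulAut.conj_apply, mul_assoc]

/-- A normal subgroup is its own conjugate: `N^{c} = N`.
(bookkeeping for "up to isomorphism" in [EtTh] Def 2.1) [cite: MochizukiEtTh2009, Def 2.1 p.36] -/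
theorem map_conj_of_normal {G : Type*} [Group G] (N : Subgroup G) (hN : N.Normal) (c : G) :
    N.map (MulAut.conj c).toMonoidHom = N := by
  ext x
  constructor
  · rintro ⟨y, hy, rfl⟩
    exact hN.conj_mem y hy c
  · intro hx
    exact ⟨c⁻¹ * x * c⁻¹⁻¹, hN.conj_mem x hx c⁻¹, by simp [MulAut.conj_apply, mul_assoc]⟩

/-- The whole group is its own conjugate: `Π_C^{c} = Π_C`.
(bookkeeping for [EtTh] Def 2.1) [cite: MochizukiEtTh2009, Def 2.1 p.36] -/
theorem map_conj_top {G : Type*} [Group G] (c : G) :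
    (⊤ : Subgroup G).map (MulAut.conj c).toMonoidHom = ⊤ :=
  Subgroup.map_top_of_surjective _ (MulAut.conj c).surjective

/-! ## Introduction rules: the constructed coverings are of their type -/

variable {X}

/-- **Def 2.1**: the covering `X̲ → X` attached to a choice of `Π̄^ell_X ↠ Q` is of type `(1, l-tors)`
(take the identity isomorphism, i.e. conjugate by `1`). [cite: MochizukiEtTh2009, Def 2.1 p.36] -/
theorem IsTypeLTors.ofTypeLTors {H : Subgroup X.PiC} (hH : X.IsTypeLTors H) : X.OfTypeLTors H :=
  ⟨1, by rw [map_conj_one]; exact hH⟩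

/-- **Def 2.1**: the orbicurve `C̲` attached to `X̲` is of type `(1, l-tors)±`.
[cite: MochizukiEtTh2009, Def 2.1 p.36] -/
theorem IsTypeLTorsPm.ofTypeLTorsPm {H' : Subgroup X.PiC} (hH' : X.IsTypeLTorsPm H') :
    X.OfTypeLTorsPm H' :=
  ⟨1, by rw [map_conj_one]; exact hH'⟩

/-- **Def 2.3**: the covering `X̲̲ → X̲` constructed in Prop 2.2 (ii) is of type `(1, l-torsΘ)`.
[cite: MochizukiEtTh2009, Def 2.3 p.38] -/
theorem IsTypeLTorsTheta.ofTypeLTorsTheta {H2 : Subgroup X.PiC} (hH2 : X.IsTypeLTorsTheta H2) :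
    X.OfTypeLTorsTheta H2 :=
  ⟨1, by rw [map_conj_one]; exact hH2⟩

/-- **Def 2.3**: the orbicurve `C̲̲` constructed in Prop 2.2 (iii) is of type `(1, l-torsΘ)±`.
[cite: MochizukiEtTh2009, Def 2.3 p.38] -/
theorem IsTypeLTorsThetaPm.ofTypeLTorsThetaPm {H2' : Subgroup X.PiC}
    (hH2' : X.IsTypeLTorsThetaPm H2') : X.OfTypeLTorsThetaPm H2' :=
  ⟨1, by rw [map_conj_one]; exact hH2'⟩

/-- **Def 2.3 from the data of Prop 2.2 (ii)**: for `Π_C̲ = H'` of type `(1, l-tors)±`, an inversion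
`ι̲ ∈ Π_C̲`, the `(−1)`-eigenspace `E = Im(s_ι)` and a splitting `S` of `D_x ↠ G_K`, the subgroup
`Π_X̲̲ := S · E` is of type `(1, l-torsΘ)`. [cite: MochizukiEtTh2009, Def 2.3 p.38] -/
theorem ofTypeLTorsTheta_of_data {H' E S : Subgroup X.PiC} {ι : X.PiC} (hH' : X.IsTypeLTorsPm H')
    (hι : X.IsInversion H' ι) (hE : X.IsMinusEigen (H' ⊓ X.PiX) H' ι E) (hS : X.IsSplitting S) :
    X.OfTypeLTorsTheta (S ⊔ E) :=
  IsTypeLTorsTheta.ofTypeLTorsTheta ⟨⟨H', E, S, ι, hH', hι, hE, hS, rfl⟩⟩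

/-- **Def 2.3 from the data of Prop 2.2 (iii)**: with moreover `ι̲` of order `2` in `Δ̄_C̲`
(`ι̲² ∈ Ker(Δ_X ↠ Δ̄_X)`), the subgroup `Π_C̲̲ := ⟨Π_X̲̲, ι̲⟩` is of type `(1, l-torsΘ)±`.
[cite: MochizukiEtTh2009, Def 2.3 p.38] -/
theorem ofTypeLTorsThetaPm_of_data {H' E S : Subgroup X.PiC} {ι : X.PiC} (hH' : X.IsTypeLTorsPm H')
    (hι : X.IsInversion H' ι) (hι2 : ι * ι ∈ X.barKer) (hE : X.IsMinusEigen (H' ⊓ X.PiX) H' ι E)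
    (hS : X.IsSplitting S) : X.OfTypeLTorsThetaPm ((S ⊔ E) ⊔ Subgroup.zpowers ι) :=
  IsTypeLTorsThetaPm.ofTypeLTorsThetaPm ⟨⟨H', E, S, ι, hH', hι, hι2, hE, hS, rfl⟩⟩

/-! ## "Up to isomorphism": invariance under `Π_C`-conjugation -/

/-- **Def 2.1, "up to isomorphism"**: being of type `(1, l-tors)` is invariant under `Π_C`-conjugation
(= isomorphism over the `K`-core `C`). [cite: MochizukiEtTh2009, Def 2.1 p.36] -/
theorem ofTypeLTors_map_conj_iff (H : Subgroup X.PiC) (d : X.PiC) :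
    X.OfTypeLTors (H.map (MulAut.conj d).toMonoidHom) ↔ X.OfTypeLTors H := by
  constructor
  · rintro ⟨c, hc⟩
    exact ⟨c * d, by rw [← map_conj_map_conj]; exact hc⟩
  · rintro ⟨c, hc⟩
    exact ⟨c * d⁻¹, by rw [map_conj_map_conj, inv_mul_cancel_right]; exact hc⟩

/-- **Def 2.1, "up to isomorphism"**: being of type `(1, l-tors)±` is invariant under `Π_C`-conjugation.
[cite: MochizukiEtTh2009, Def 2.1 p.36] -/
theorem ofTypeLTorsPm_map_conj_iff (H' : Subgroup X.PiC) (d : X.PiC) :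
    X.OfTypeLTorsPm (H'.map (MulAut.conj d).toMonoidHom) ↔ X.OfTypeLTorsPm H' := by
  constructor
  · rintro ⟨c, hc⟩
    exact ⟨c * d, by rw [← map_conj_map_conj]; exact hc⟩
  · rintro ⟨c, hc⟩
    exact ⟨c * d⁻¹, by rw [map_conj_map_conj, inv_mul_cancel_right]; exact hc⟩

/-- **Def 2.3, "up to isomorphism"**: being of type `(1, l-torsΘ)` is invariant under `Π_C`-conjugation.
[cite: MochizukiEtTh2009, Def 2.3 p.38] -/
theorem ofTypeLTorsTheta_map_conj_iff (H2 : Subgroup X.PiC) (d : X.PiC) :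
    X.OfTypeLTorsTheta (H2.map (MulAut.conj d).toMonoidHom) ↔ X.OfTypeLTorsTheta H2 := by
  constructor
  · rintro ⟨c, hc⟩
    exact ⟨c * d, by rw [← map_conj_map_conj]; exact hc⟩
  · rintro ⟨c, hc⟩
    exact ⟨c * d⁻¹, by rw [map_conj_map_conj, inv_mul_cancel_right]; exact hc⟩

/-- **Def 2.3, "up to isomorphism"**: being of type `(1, l-torsΘ)±` is invariant under `Π_C`-conjugation.
[cite: MochizukiEtTh2009, Def 2.3 p.38] -/
theorem ofTypeLTorsThetaPm_map_conj_iff (H2' : Subgroup X.PiC) (d : X.PiC) :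
    X.OfTypeLTorsThetaPm (H2'.map (MulAut.conj d).toMonoidHom) ↔ X.OfTypeLTorsThetaPm H2' := by
  constructor
  · rintro ⟨c, hc⟩
    exact ⟨c * d, by rw [← map_conj_map_conj]; exact hc⟩
  · rintro ⟨c, hc⟩
    exact ⟨c * d⁻¹, by rw [map_conj_map_conj, inv_mul_cancel_right]; exact hc⟩

/-! ## Consequences for a curve of type `(1, l-tors)` (Remark 2.3.1, up-to-isomorphism form) -/

/-- A curve of type `(1, l-tors)` covers `X`: its `Π` lies in `Π_X` (`Π_X ⊲ Π_C`, so conjugating back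
preserves the inclusion). [cite: MochizukiEtTh2009, Def 2.1 p.36] -/
theorem OfTypeLTors.le_PiX {H : Subgroup X.PiC} (hH : X.OfTypeLTors H) : H ≤ X.PiX := by
  obtain ⟨c, hc⟩ := hH
  intro x hx
  have hcx : (MulAut.conj c).toMonoidHom x ∈ H.map (MulAut.conj c).toMonoidHom :=
    Subgroup.mem_map_of_mem _ hx
  have h1 := hc.le hcx
  have h2 := X.PiX_normal.conj_mem _ h1 c⁻¹
  simpa [MulAut.conj_apply, mul_assoc] using h2

/-- **Remark 2.3.1, up to isomorphism**: `[Π_X : Π] = l` for every curve of type `(1, l-tors)`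
("extracting a single copy of `ℤ/lℤ`"; from `index_typeLTors` of the statement file, transported
along the conjugation since `Π_X ⊲ Π_C`). [cite: MochizukiEtTh2009, Rmk 2.3.1 p.38] -/
theorem OfTypeLTors.relIndex_eq {H : Subgroup X.PiC} (hH : X.OfTypeLTors H) :
    H.relIndex X.PiX = l := by
  obtain ⟨c, hc⟩ := hH
  have h := X.index_typeLTors _ hc
  rw [← map_conj_of_normal X.PiX X.PiX_normal c,
    Subgroup.relIndex_map_map_of_injective _ _ (MulAut.conj c).injective] at h
  exact h

/-! ## The degenerate arguments are of no type -/

/-- `Π_C` itself is NOT of type `(1, l-tors)`: a `Π_X̲` lies in `Π_X`, which has index `2` in `Π_C`.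
In particular `OfTypeLTors` does not hold of every subgroup. [cite: MochizukiEtTh2009, Def 2.1 p.36] -/
theorem not_ofTypeLTors_top : ¬ X.OfTypeLTors ⊤ := by
  intro h
  have htop : (⊤ : Subgroup X.PiC) ≤ X.PiX := h.le_PiX
  have h1 : X.PiX.index = 1 := Subgroup.index_eq_one.mpr (top_le_iff.mp htop)
  have h2 := X.index_PiX
  omega

/-- The trivial subgroup is NOT of type `(1, l-tors)±`: `[Π_C̲ : Π_C̲ ∩ Π_X] = 2`, whereas
`[1 : 1 ∩ Π_X] = 1`. In particular `OfTypeLTorsPm` does not hold of every subgroup.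
[cite: MochizukiEtTh2009, Def 2.1 p.36] -/
theorem not_ofTypeLTorsPm_bot : ¬ X.OfTypeLTorsPm ⊥ := by
  rintro ⟨c, hc⟩
  rw [Subgroup.map_bot] at hc
  have h := hc.relIndex_two
  rw [Subgroup.relIndex_bot_right] at h
  omega

/-- `Π_C` itself is NOT of type `(1, l-torsΘ)`: `Π_X̲̲ = S · E` with `S ⊆ D_x · Ker ⊆ Π_X` and
`E ⊆ Δ_X̲ ⊆ Π_X`, and `[Π_C : Π_X] = 2`. In particular `OfTypeLTorsTheta` does not hold of every
subgroup. [cite: MochizukiEtTh2009, Def 2.3 p.38] -/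
theorem not_ofTypeLTorsTheta_top : ¬ X.OfTypeLTorsTheta ⊤ := by
  rintro ⟨c, ⟨H', E, S, ι, -, -, hE, hS, htop⟩⟩
  rw [map_conj_top] at htop
  have hE' : E ≤ X.PiX := le_trans hE.le (le_trans inf_le_left inf_le_right)
  have hS' : S ≤ X.PiX := by
    refine le_trans hS.le (sup_le X.Dx_le ?_)
    exact le_trans X.barKer_le_barTheta (le_trans X.barTheta_le inf_le_left)
  have hle : (⊤ : Subgroup X.PiC) ≤ X.PiX := by rw [htop]; exact sup_le hS' hE'
  have h1 : X.PiX.index = 1 := Subgroup.index_eq_one.mpr (top_le_iff.mp hle)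
  have h2 := X.index_PiX
  omega

/-- The trivial subgroup is NOT of type `(1, l-torsΘ)±`: `Π_C̲̲ = ⟨Π_X̲̲, ι̲⟩` contains the inversion
`ι̲ ∉ Π_X`, hence `ι̲ ≠ 1`. In particular `OfTypeLTorsThetaPm` does not hold of every subgroup.
[cite: MochizukiEtTh2009, Def 2.3 p.38] -/
theorem not_ofTypeLTorsThetaPm_bot : ¬ X.OfTypeLTorsThetaPm ⊥ := by
  rintro ⟨c, ⟨H', E, S, ι, -, hι, -, -, -, hbot⟩⟩
  rw [Subgroup.map_bot] at hbot
  have hmem : ι ∈ (S ⊔ E) ⊔ Subgroup.zpowers ι := Subgroup.mem_sup_right (Subgroup.mem_zpowers ι)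
  rw [← hbot, Subgroup.mem_bot] at hmem
  exact hι.not_mem (hmem ▸ X.PiX.one_mem)

/-! ## Remark 2.3.1 for curves of type `(1, l-torsΘ)`: "extracting two copies of `ℤ/lℤ`" (appended 2026-08-26) -/

/-- A subgroup of type `(1, l-torsΘ)` in the literal (un-conjugated) sense lies in `Π_X`:
`Π_X̲̲ = S · E ⊆ D_x · Ker ⊔ Δ_X̲ ⊆ Π_X`. [cite: MochizukiEtTh2009, Def 2.3 p.38] -/
theorem IsTypeLTorsTheta.le_PiX {H2 : Subgroup X.PiC} (hH2 : X.IsTypeLTorsTheta H2) : H2 ≤ X.PiX := by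
  obtain ⟨H', E, S, ι, -, -, hE, hS, rfl⟩ := hH2.out
  have hE' : E ≤ X.PiX := le_trans hE.le (le_trans inf_le_left inf_le_right)
  have hS' : S ≤ X.PiX := by
    refine le_trans hS.le (sup_le X.Dx_le ?_)
    exact le_trans X.barKer_le_barTheta (le_trans X.barTheta_le inf_le_left)
  exact sup_le hS' hE'

/-- **Remark 2.3.1, double underline** (literal form): `[Π_X : Π_X̲̲] = l · l` for `Π_X̲̲ = S · E` constructed from
`Π_C̲ = H'` of type `(1, l-tors)±` — "the double underline corresponds to extracting two copies of `ℤ/lℤ`":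
`[Π_X : Π_X̲] = l` (`index_typeLTors`) and `[Π_X̲ : Π_X̲̲] = l` (`index_typeLTorsTheta`).
[cite: MochizukiEtTh2009, Rmk 2.3.1 p.38] -/
theorem IsTypeLTorsTheta.relIndex_eq {H2 : Subgroup X.PiC} (hH2 : X.IsTypeLTorsTheta H2) :
    H2.relIndex X.PiX = l * l := by
  obtain ⟨H', E, S, ι, hH', hι, hE, hS, rfl⟩ := hH2.out
  have hT := hH'.inf_isTypeLTors
  have hSle : S ≤ H' ⊓ X.PiX :=
    hS.le.trans (sup_le hT.Dx_le (X.barKer_le_barTheta.trans hT.barTheta_le))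
  have hEle : E ≤ H' ⊓ X.PiX := hE.le.trans inf_le_left
  have h1 : (S ⊔ E).relIndex (H' ⊓ X.PiX) = l := X.index_typeLTorsTheta H' E S ι hH' hE hS
  have h2 : (H' ⊓ X.PiX).relIndex X.PiX = l := X.index_typeLTors _ hT
  rw [← Subgroup.relIndex_mul_relIndex (S ⊔ E) (H' ⊓ X.PiX) X.PiX (sup_le hSle hEle) inf_le_right, h1, h2]

/-- A curve of type `(1, l-torsΘ)` covers `X`: its `Π` lies in `Π_X` (up to isomorphism; `Π_X ⊲ Π_C`).
[cite: MochizukiEtTh2009, Def 2.3 p.38] -/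
theorem OfTypeLTorsTheta.le_PiX {H2 : Subgroup X.PiC} (hH2 : X.OfTypeLTorsTheta H2) : H2 ≤ X.PiX := by
  obtain ⟨c, hc⟩ := hH2
  intro x hx
  have hcx : (MulAut.conj c).toMonoidHom x ∈ H2.map (MulAut.conj c).toMonoidHom :=
    Subgroup.mem_map_of_mem _ hx
  have h1 := hc.le_PiX hcx
  have h2 := X.PiX_normal.conj_mem _ h1 c⁻¹
  simpa [MulAut.conj_apply, mul_assoc] using h2

/-- **Remark 2.3.1, double underline, up to isomorphism**: `[Π_X : Π] = l · l` for EVERY curve of type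
`(1, l-torsΘ)` ("extracting two copies of `ℤ/lℤ`"; transported along the `Π_C`-conjugation since `Π_X ⊲ Π_C`).
[cite: MochizukiEtTh2009, Rmk 2.3.1 p.38] -/
theorem OfTypeLTorsTheta.relIndex_eq {H2 : Subgroup X.PiC} (hH2 : X.OfTypeLTorsTheta H2) :
    H2.relIndex X.PiX = l * l := by
  obtain ⟨c, hc⟩ := hH2
  have h := hc.relIndex_eq
  rw [← map_conj_of_normal X.PiX X.PiX_normal c,
    Subgroup.relIndex_map_map_of_injective _ _ (MulAut.conj c).injective] at h
  exact h

/-! ## Degrees over `C`: `[Π_C : Π_C̲] = l`, `[Π_C : Π_X̲] = 2 · l`, `[Π_C : Π_X̲̲] = 2 · l · l` (appended 2026-08-26) -/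

/-- `[Π_C : Π_X̲] = 2 · l` for `Π_X̲` of type `(1, l-tors)` in the literal sense (`[Π_C : Π_X] = 2`,
`[Π_X : Π_X̲] = l`). [cite: MochizukiEtTh2009, Def 2.1 p.36] -/
theorem IsTypeLTors.index_eq {H : Subgroup X.PiC} (hH : X.IsTypeLTors H) : H.index = l * 2 := by
  rw [← Subgroup.relIndex_mul_index hH.le, X.index_typeLTors H hH, X.index_PiX]

/-- **`C̲ → C` has degree `l`**: `[Π_C : Π_C̲] = l` for `Π_C̲` of type `(1, l-tors)±` in the literal sense
(`[Π_C̲ : Π_X̲] = 2`, `[Π_C : Π_X̲] = 2 · l`). [cite: MochizukiEtTh2009, Def 2.1 p.36] -/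
theorem IsTypeLTorsPm.index_eq {H' : Subgroup X.PiC} (hH' : X.IsTypeLTorsPm H') : H'.index = l := by
  have h1 : (H' ⊓ X.PiX).index = l * 2 := hH'.inf_isTypeLTors.index_eq
  have h2 : (H' ⊓ X.PiX).relIndex H' * H'.index = (H' ⊓ X.PiX).index :=
    Subgroup.relIndex_mul_index inf_le_left
  rw [hH'.relIndex_two, h1] at h2
  omega

/-- `[Π_C : Π] = 2 · l` for every curve of type `(1, l-tors)` (up to isomorphism: the index is invariant under
`Π_C`-conjugation). [cite: MochizukiEtTh2009, Def 2.1 p.36] -/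
theorem OfTypeLTors.index_eq {H : Subgroup X.PiC} (hH : X.OfTypeLTors H) : H.index = l * 2 := by
  obtain ⟨c, hc⟩ := hH
  rw [← Subgroup.index_map_equiv H (MulAut.conj c)]
  exact hc.index_eq

/-- **`[Π_C : Π] = l` for every curve of type `(1, l-tors)±`** (up to isomorphism).
[cite: MochizukiEtTh2009, Def 2.1 p.36] -/
theorem OfTypeLTorsPm.index_eq {H' : Subgroup X.PiC} (hH' : X.OfTypeLTorsPm H') : H'.index = l := by
  obtain ⟨c, hc⟩ := hH'
  rw [← Subgroup.index_map_equiv H' (MulAut.conj c)]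
  exact hc.index_eq

/-- `[Π_C : Π] = 2 · l · l` for every curve of type `(1, l-torsΘ)` (up to isomorphism; Rmk 2.3.1's two copies of
`ℤ/lℤ` below `Π_X`, which has index `2`). [cite: MochizukiEtTh2009, Rmk 2.3.1 p.38] -/
theorem OfTypeLTorsTheta.index_eq {H2 : Subgroup X.PiC} (hH2 : X.OfTypeLTorsTheta H2) :
    H2.index = l * l * 2 := by
  rw [← Subgroup.relIndex_mul_index hH2.le_PiX, hH2.relIndex_eq, X.index_PiX]

/-! ## Degree of `C̲̲ → C`: `[Π_C : Π_C̲̲] = l · l` (appended 2026-08-26; uses [EtTh] Prop 2.2 (iii) over the bare interface,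
`CoverData.relIndex_sup_zpowers` of `Discharge/Sec2Prop22iiiOfCoverData.lean`, abc-iut-w6-d082) -/

/-- `[Π_C : Π_C̲̲] = l · l` for `Π_C̲̲ = ⟨Π_X̲̲, ι̲⟩` in the literal sense: `[Π_C : Π_X̲̲] = 2 · l · l`
(`IsTypeLTorsTheta`) and `[Π_C̲̲ : Π_X̲̲] = 2` (Prop 2.2 (iii), `ι̲² ∈ Ker`). [cite: MochizukiEtTh2009, Def 2.3 p.38] -/
theorem IsTypeLTorsThetaPm.index_eq {H2' : Subgroup X.PiC} (hH2' : X.IsTypeLTorsThetaPm H2') :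
    H2'.index = l * l := by
  obtain ⟨H', E, S, ι, hH', hι, hι2, hE, hS, rfl⟩ := hH2'.out
  have hΘ : X.IsTypeLTorsTheta (S ⊔ E) := ⟨⟨H', E, S, ι, hH', hι, hE, hS, rfl⟩⟩
  have h1 : (S ⊔ E).index = l * l * 2 := by
    rw [← Subgroup.relIndex_mul_index hΘ.le_PiX, hΘ.relIndex_eq, X.index_PiX]
  have h2 : (S ⊔ E).relIndex ((S ⊔ E) ⊔ Subgroup.zpowers ι) = 2 :=
    X.relIndex_sup_zpowers hH' rfl hι hE hS hι2
  have h3 : (S ⊔ E).relIndex ((S ⊔ E) ⊔ Subgroup.zpowers ι) * ((S ⊔ E) ⊔ Subgroup.zpowers ι).index =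
      (S ⊔ E).index := Subgroup.relIndex_mul_index le_sup_left
  rw [h2, h1] at h3
  omega

/-- **`[Π_C : Π] = l · l` for every curve of type `(1, l-torsΘ)±`** (up to isomorphism) — the degree of
`C̲̲ → C`. [cite: MochizukiEtTh2009, Def 2.3 p.38] -/
theorem OfTypeLTorsThetaPm.index_eq {H2' : Subgroup X.PiC} (hH2' : X.OfTypeLTorsThetaPm H2') :
    H2'.index = l * l := by
  obtain ⟨c, hc⟩ := hH2'
  rw [← Subgroup.index_map_equiv H2' (MulAut.conj c)]
  exact hc.index_eq

end CoverData

end ThetaCovers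

end Literature.AnabelianGeometry.EtaleTheta
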